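import Summits.Parity.GeneralizedHardyLittlewood.Theorems.GreenTaoLevelTwoMNTwoFourierReplaceBox
import Summits.Parity.GeneralizedHardyLittlewood.Theorems.GreenTaoLevelTwoMNTwoBohrGauge

/-!
# Route `GreenTaoLevelTwo`, crux `MNTwo` (stmt-Parity-21276), line `birth`, stub `stub_mnVertical`:
# replacing the sixteenth cutoff by a character (GT 2008b §10, proof of Lemma 24, (llm))

Step 6 of the remaining Lemma-24 assembly for `stub_mnVertical`, in concrete form (B. Green, T. Tao,
*Quadratic uniformity of the Möbius function*, Ann. Inst. Fourier 58 (2008) = arXiv:math/0606087,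
§10: "we need to deal with the exceptional cutoff `ψ(P(l₀+l₁+l₂, m₀+m₁+m₂))` first … we can
approximate `Ψ` uniformly to accuracy `O(δ)` … by a linear combination of at most `O(δ^{-C})`
characters").  Def-free: in the sixteenfold cutoff–phase sum of `…MNTwoSixteenSum.sixteen_sum_eq`
(output of `…MNTwoTypeIILargeSixteen.typeII_large_sixteen`) the sixteenth cutoff
`wt(l₀+l₂+l₁, m₀+m₂+m₁) = χ₁(l₁,l₂)χ₂(m₁,m₂)ψ(P(l₀+l₂+l₁, m₀+m₂+m₁))` is replaced, given a
`δ`-accurate expansion `ψ(n) ≈ ∑_{j<J} c_j e(β_j n)` on `B(n₀,3ρ)` (the hypothesis `happ` — AIF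
Lemma 37 for the Bohr-gauge cutoff), by one character `e(β_j P)`: whenever the other fifteen
cutoffs are non-zero, `P(l₀+l₂+l₁,·) = P(l₀+l₁,·) + P(l₀+l₂,·) − P(l₀,·)` lies in `B(n₀,3ρ)`.  The
output is the hypothesis `hlarge` of `…MNTwoRegroupedDenominator.regrouped_denominator` (with
`β = β_j`, `χ₁, χ₂` the box indicators).

* `sixteenth_factor_replace` — the statement just described.

References: [GreenTao2008QuadraticMobius] arXiv:math/0606087 §10 (proof of Lemma 24), Lemma 37.
-/

noncomputable section

open Finset
open scoped FourierTransform

namespace Summit.Parity.GeneralizedHardyLittlewood.GreenTaoLevelTwoMNTwoSixteenthFactor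

open Summit.Parity.GeneralizedHardyLittlewood.GreenTaoLevelTwoMNTwoFourierReplaceBox
  (fourier_replace_box)
open Summit.Parity.GeneralizedHardyLittlewood.GreenTaoLevelTwoMNTwoBohrGauge
  (bohrGauge_nonneg bohrGauge_neg bohrGauge_add_le)

variable {k : ℕ}

/-- `|x| ≤ 1` and `|y| ≤ 1` give `|x·y| ≤ 1`. [folklore] -/
theorem abs_mul_le_one {x y : ℝ} (hx : |x| ≤ 1) (hy : |y| ≤ 1) : |x * y| ≤ 1 := by
  rw [abs_mul]; exact mul_le_one₀ hx (abs_nonneg _) hy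

/-- **Replacing the sixteenth cutoff by a character.**  See the module docstring.
[cite: GreenTao2008QuadraticMobius, §10 (proof of Lemma 24, treatment of the exceptional cutoff)] -/
theorem sixteenth_factor_replace (α : Fin k → ℝ) (N : ℕ) (n₀ : ℤ) {ρ : ℝ} (ψ : ℤ → ℝ)
    (hψ0 : ∀ n, 0 ≤ ψ n) (hψ1 : ∀ n, ψ n ≤ 1)
    (hsupp : ∀ n, ψ n ≠ 0 →
      (⨆ i : Fin k, ‖((((n - n₀ : ℤ) : ℝ) * α i : ℝ) : AddCircle (1 : ℝ))‖) +
        |((n - n₀ : ℤ) : ℝ)| / N < ρ)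
    (d w s t l₀ m₀ : ℤ) (L M : ℕ) (θ : ℝ) (wt : ℤ → ℤ → ℝ)
    (hwt : ∀ l m, wt l m = if l ∈ Icc (1 : ℤ) L ∧ m ∈ Icc (1 : ℤ) M
      then ψ ((d + s * l) * (w + t * m)) else 0)
    {J : ℕ} (hJ : 1 ≤ J) (c : ℕ → ℂ) {C δ Y : ℝ} (hc : ∀ j ∈ range J, ‖c j‖ ≤ C) (hC : 0 < C)
    (hδ : 0 ≤ δ) (β : ℕ → ℝ)
    (happ : ∀ n : ℤ,
      (⨆ i : Fin k, ‖((((n - n₀ : ℤ) : ℝ) * α i : ℝ) : AddCircle (1 : ℝ))‖) +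
          |((n - n₀ : ℤ) : ℝ)| / N < 3 * ρ →
        ‖((ψ n : ℝ) : ℂ) - ∑ j ∈ range J, c j * (𝐞 (β j * (n : ℝ)) : ℂ)‖ ≤ δ)
    (hY : Y ≤ (
    ∑ l₁ ∈ Icc (-(L : ℤ)) L, ∑ m₁ ∈ Icc (-(M : ℤ)) M, ∑ l₂ ∈ Icc (-(L : ℤ)) L,
      ∑ m₂ ∈ Icc (-(M : ℤ)) M,
      (((wt l₀ m₀ * wt l₀ (m₀ + m₁) * wt (l₀ + l₁) m₀ * wt (l₀ + l₁) (m₀ + m₁)) *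
        (wt l₀ (m₀ + m₂) * wt l₀ (m₀ + m₂ + m₁) * wt (l₀ + l₁) (m₀ + m₂) *
          wt (l₀ + l₁) (m₀ + m₂ + m₁)) *
        (wt (l₀ + l₂) m₀ * wt (l₀ + l₂) (m₀ + m₁) * wt (l₀ + l₂ + l₁) m₀ *
          wt (l₀ + l₂ + l₁) (m₀ + m₁)) *
        (wt (l₀ + l₂) (m₀ + m₂) * wt (l₀ + l₂) (m₀ + m₂ + m₁) * wt (l₀ + l₂ + l₁) (m₀ + m₂) *
          wt (l₀ + l₂ + l₁) (m₀ + m₂ + m₁)) : ℝ) : ℂ) *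
      (𝐞 (2 * θ * l₁ * l₂ * m₁ * m₂) : ℂ)).re) :
    ∃ j ∈ range J, (Y - δ * (((2 * L + 1 : ℕ)) : ℝ) ^ 2 * (((2 * M + 1 : ℕ)) : ℝ) ^ 2) / (J * C) ≤
      ‖∑ l₁ ∈ Icc (-(L : ℤ)) L, ∑ m₁ ∈ Icc (-(M : ℤ)) M, ∑ l₂ ∈ Icc (-(L : ℤ)) L,
        ∑ m₂ ∈ Icc (-(M : ℤ)) M,
        (((wt l₀ m₀ * wt l₀ (m₀ + m₁) * wt (l₀ + l₁) m₀ * wt (l₀ + l₁) (m₀ + m₁)) *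
            (wt l₀ (m₀ + m₂) * wt l₀ (m₀ + m₂ + m₁) * wt (l₀ + l₁) (m₀ + m₂) *
              wt (l₀ + l₁) (m₀ + m₂ + m₁)) *
            (wt (l₀ + l₂) m₀ * wt (l₀ + l₂) (m₀ + m₁) * wt (l₀ + l₂ + l₁) m₀ *
              wt (l₀ + l₂ + l₁) (m₀ + m₁)) *
            (wt (l₀ + l₂) (m₀ + m₂) * wt (l₀ + l₂) (m₀ + m₂ + m₁) * wt (l₀ + l₂ + l₁) (m₀ + m₂)) *
            (if l₀ + l₂ + l₁ ∈ Icc (1 : ℤ) L then (1 : ℝ) else 0) *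
            (if m₀ + m₂ + m₁ ∈ Icc (1 : ℤ) M then (1 : ℝ) else 0) : ℝ) : ℂ) *
          (𝐞 (β j * ((d + s * (l₀ + l₂ + l₁)) * (w + t * (m₀ + m₂ + m₁)) : ℤ)) : ℂ) *
          (𝐞 (2 * θ * l₁ * l₂ * m₁ * m₂) : ℂ)‖ := by
  classical
  -- the gauge and its symmetry / subadditivity
  set ν : ℤ → ℝ := fun n => (⨆ i : Fin k, ‖(((n : ℝ) * α i : ℝ) : AddCircle (1 : ℝ))‖) +
    |(n : ℝ)| / N with hν
  have hνneg : ∀ x, ν (-x) = ν x := fun x => bohrGauge_neg α N x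
  have hνadd : ∀ x y, ν (x + y) ≤ ν x + ν y := fun x y => bohrGauge_add_le α N x y
  have hsuppν : ∀ n, ψ n ≠ 0 → ν (n - n₀) < ρ := fun n hn => hsupp n hn
  have happν : ∀ n : ℤ, ν (n - n₀) < 3 * ρ →
      ‖((ψ n : ℝ) : ℂ) - ∑ j ∈ range J, c j * (𝐞 (β j * (n : ℝ)) : ℂ)‖ ≤ δ := fun n hn => happ n hn
  -- the cutoff is `[0,1]`-valued
  have hwt1 : ∀ l m, |wt l m| ≤ 1 := by
    intro l m
    rw [hwt]
    split_ifs
    · rw [abs_of_nonneg (hψ0 _)]; exact hψ1 _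
    · simp
  have hwt_ne : ∀ l m, wt l m ≠ 0 →
      (l ∈ Icc (1 : ℤ) L ∧ m ∈ Icc (1 : ℤ) M) ∧ ψ ((d + s * l) * (w + t * m)) ≠ 0 := by
    intro l m h
    rw [hwt] at h
    by_cases hlm : l ∈ Icc (1 : ℤ) L ∧ m ∈ Icc (1 : ℤ) M
    · rw [if_pos hlm] at h; exact ⟨hlm, h⟩
    · rw [if_neg hlm] at h; exact absurd rfl h
  have hχ : ∀ (P : Prop) [Decidable P], |(if P then (1 : ℝ) else 0)| ≤ 1 := by
    intro P _; split_ifs <;> simp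
  -- the weight `W`, the factor `a`, the phase `g` and the characters `e j`
  set W : ℤ → ℤ → ℤ → ℤ → ℝ := fun l₁ m₁ l₂ m₂ =>
    (wt l₀ m₀ * wt l₀ (m₀ + m₁) * wt (l₀ + l₁) m₀ * wt (l₀ + l₁) (m₀ + m₁)) *
            (wt l₀ (m₀ + m₂) * wt l₀ (m₀ + m₂ + m₁) * wt (l₀ + l₁) (m₀ + m₂) *
              wt (l₀ + l₁) (m₀ + m₂ + m₁)) *
            (wt (l₀ + l₂) m₀ * wt (l₀ + l₂) (m₀ + m₁) * wt (l₀ + l₂ + l₁) m₀ *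
              wt (l₀ + l₂ + l₁) (m₀ + m₁)) *
            (wt (l₀ + l₂) (m₀ + m₂) * wt (l₀ + l₂) (m₀ + m₂ + m₁) * wt (l₀ + l₂ + l₁) (m₀ + m₂)) *
            (if l₀ + l₂ + l₁ ∈ Icc (1 : ℤ) L then (1 : ℝ) else 0) *
            (if m₀ + m₂ + m₁ ∈ Icc (1 : ℤ) M then (1 : ℝ) else 0) with hW
  set a : ℤ → ℤ → ℤ → ℤ → ℂ := fun l₁ m₁ l₂ m₂ =>
    ((ψ ((d + s * (l₀ + l₂ + l₁)) * (w + t * (m₀ + m₂ + m₁))) : ℝ) : ℂ) with ha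
  set g : ℤ → ℤ → ℤ → ℤ → ℂ := fun l₁ m₁ l₂ m₂ => (𝐞 (2 * θ * l₁ * l₂ * m₁ * m₂) : ℂ) with hg
  set e : ℕ → ℤ → ℤ → ℤ → ℤ → ℂ := fun j l₁ m₁ l₂ m₂ =>
    (𝐞 (β j * ((d + s * (l₀ + l₂ + l₁)) * (w + t * (m₀ + m₂ + m₁)) : ℤ)) : ℂ) with he
  -- `|W| ≤ 1`
  have hWle : ∀ l₁ m₁ l₂ m₂, |W l₁ m₁ l₂ m₂| ≤ 1 := by
    intro l₁ m₁ l₂ m₂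
    simp only [hW]
    have h := hwt1
    refine abs_mul_le_one (abs_mul_le_one ?_ (hχ _)) (hχ _)
    refine abs_mul_le_one (abs_mul_le_one (abs_mul_le_one ?_ ?_) ?_) ?_
    · exact abs_mul_le_one (abs_mul_le_one (abs_mul_le_one (h _ _) (h _ _)) (h _ _)) (h _ _)
    · exact abs_mul_le_one (abs_mul_le_one (abs_mul_le_one (h _ _) (h _ _)) (h _ _)) (h _ _)
    · exact abs_mul_le_one (abs_mul_le_one (abs_mul_le_one (h _ _) (h _ _)) (h _ _)) (h _ _)
    · exact abs_mul_le_one (abs_mul_le_one (h _ _) (h _ _)) (h _ _)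
  have hgle : ∀ l₁ m₁ l₂ m₂, ‖g l₁ m₁ l₂ m₂‖ ≤ 1 := fun _ _ _ _ => (Circle.norm_coe _).le
  -- the sixteenth cutoff factors
  have hwt16 : ∀ l₁ m₁ l₂ m₂ : ℤ, wt (l₀ + l₂ + l₁) (m₀ + m₂ + m₁) =
      (if l₀ + l₂ + l₁ ∈ Icc (1 : ℤ) L then (1 : ℝ) else 0) *
        (if m₀ + m₂ + m₁ ∈ Icc (1 : ℤ) M then (1 : ℝ) else 0) *
        ψ ((d + s * (l₀ + l₂ + l₁)) * (w + t * (m₀ + m₂ + m₁))) := by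
    intro l₁ m₁ l₂ m₂
    rw [hwt]
    by_cases h1 : l₀ + l₂ + l₁ ∈ Icc (1 : ℤ) L <;> by_cases h2 : m₀ + m₂ + m₁ ∈ Icc (1 : ℤ) M <;>
      simp [h1, h2]
  -- termwise identity: sixteen cutoffs × phase = `W · a · g`
  have hterm : ∀ l₁ m₁ l₂ m₂ : ℤ,
      (((wt l₀ m₀ * wt l₀ (m₀ + m₁) * wt (l₀ + l₁) m₀ * wt (l₀ + l₁) (m₀ + m₁)) *
            (wt l₀ (m₀ + m₂) * wt l₀ (m₀ + m₂ + m₁) * wt (l₀ + l₁) (m₀ + m₂) *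
              wt (l₀ + l₁) (m₀ + m₂ + m₁)) *
            (wt (l₀ + l₂) m₀ * wt (l₀ + l₂) (m₀ + m₁) * wt (l₀ + l₂ + l₁) m₀ *
              wt (l₀ + l₂ + l₁) (m₀ + m₁)) *
            (wt (l₀ + l₂) (m₀ + m₂) * wt (l₀ + l₂) (m₀ + m₂ + m₁) * wt (l₀ + l₂ + l₁) (m₀ + m₂) *
          wt (l₀ + l₂ + l₁) (m₀ + m₂ + m₁)) : ℝ) : ℂ) *
        (𝐞 (2 * θ * l₁ * l₂ * m₁ * m₂) : ℂ) =
      (W l₁ m₁ l₂ m₂ : ℂ) * a l₁ m₁ l₂ m₂ * g l₁ m₁ l₂ m₂ := by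
    intro l₁ m₁ l₂ m₂
    simp only [hW, ha, hg]
    rw [hwt16]
    push_cast
    ring
  -- the approximation where `W ≠ 0`
  have happrox : ∀ l₁ ∈ Icc (-(L : ℤ)) L, ∀ m₁ ∈ Icc (-(M : ℤ)) M, ∀ l₂ ∈ Icc (-(L : ℤ)) L,
      ∀ m₂ ∈ Icc (-(M : ℤ)) M, W l₁ m₁ l₂ m₂ ≠ 0 →
        ‖a l₁ m₁ l₂ m₂ - ∑ j ∈ range J, c j * e j l₁ m₁ l₂ m₂‖ ≤ δ := by
    intro l₁ _ m₁ _ l₂ _ m₂ _ hW0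
    -- the three cutoffs at `(l₀+l₁, m*)`, `(l₀+l₂, m*)`, `(l₀, m*)` are non-zero
    have h1 : wt (l₀ + l₁) (m₀ + m₂ + m₁) ≠ 0 := by
      intro h0; apply hW0; simp only [hW, h0, mul_zero, zero_mul]
    have h2 : wt (l₀ + l₂) (m₀ + m₂ + m₁) ≠ 0 := by
      intro h0; apply hW0; simp only [hW, h0, mul_zero, zero_mul]
    have h3 : wt l₀ (m₀ + m₂ + m₁) ≠ 0 := by
      intro h0; apply hW0; simp only [hW, h0, mul_zero, zero_mul]
    have g1 := hsuppν _ (hwt_ne _ _ h1).2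
    have g2 := hsuppν _ (hwt_ne _ _ h2).2
    have g3 := hsuppν _ (hwt_ne _ _ h3).2
    have hid : (d + s * (l₀ + l₂ + l₁)) * (w + t * (m₀ + m₂ + m₁)) - n₀ =
        ((d + s * (l₀ + l₁)) * (w + t * (m₀ + m₂ + m₁)) - n₀) +
          (((d + s * (l₀ + l₂)) * (w + t * (m₀ + m₂ + m₁)) - n₀) +
            -((d + s * l₀) * (w + t * (m₀ + m₂ + m₁)) - n₀)) := by ring
    have hν3 : ν ((d + s * (l₀ + l₂ + l₁)) * (w + t * (m₀ + m₂ + m₁)) - n₀) < 3 * ρ := by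
      rw [hid]
      calc _ ≤ ν ((d + s * (l₀ + l₁)) * (w + t * (m₀ + m₂ + m₁)) - n₀) +
            ν (((d + s * (l₀ + l₂)) * (w + t * (m₀ + m₂ + m₁)) - n₀) +
              -((d + s * l₀) * (w + t * (m₀ + m₂ + m₁)) - n₀)) := hνadd _ _
        _ ≤ ν ((d + s * (l₀ + l₁)) * (w + t * (m₀ + m₂ + m₁)) - n₀) +
            (ν ((d + s * (l₀ + l₂)) * (w + t * (m₀ + m₂ + m₁)) - n₀) +
              ν (-((d + s * l₀) * (w + t * (m₀ + m₂ + m₁)) - n₀))) := by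
            gcongr; exact hνadd _ _
        _ < 3 * ρ := by rw [hνneg]; linarith
    have := happν _ hν3
    simpa only [ha, he] using this
  -- the large sum in `W·a·g` form
  have hY' : Y ≤ ‖∑ l₁ ∈ Icc (-(L : ℤ)) L, ∑ m₁ ∈ Icc (-(M : ℤ)) M, ∑ l₂ ∈ Icc (-(L : ℤ)) L,
      ∑ m₂ ∈ Icc (-(M : ℤ)) M, (W l₁ m₁ l₂ m₂ : ℂ) * a l₁ m₁ l₂ m₂ * g l₁ m₁ l₂ m₂‖ := by
    refine hY.trans ?_
    rw [← Finset.sum_congr rfl fun l₁ _ => Finset.sum_congr rfl fun m₁ _ =>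
      Finset.sum_congr rfl fun l₂ _ => Finset.sum_congr rfl fun m₂ _ => hterm l₁ m₁ l₂ m₂]
    exact Complex.re_le_norm _
  obtain ⟨j, hj, hb⟩ := fourier_replace_box (Icc (-(L : ℤ)) L) (Icc (-(M : ℤ)) M) W hWle a g
    hgle hJ c hc hC hδ e happrox hY'
  refine ⟨j, hj, ?_⟩
  have hcL : (#(Icc (-(L : ℤ)) L) : ℝ) = ((2 * L + 1 : ℕ) : ℝ) := by
    rw [Int.card_Icc]
    have : ((L : ℤ) + 1 - -(L : ℤ)).toNat = 2 * L + 1 := by omega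
    rw [this]
  have hcM : (#(Icc (-(M : ℤ)) M) : ℝ) = ((2 * M + 1 : ℕ) : ℝ) := by
    rw [Int.card_Icc]
    have : ((M : ℤ) + 1 - -(M : ℤ)).toNat = 2 * M + 1 := by omega
    rw [this]
  rw [hcL, hcM] at hb
  simpa only [hW, he, hg] using hb

end Summit.Parity.GeneralizedHardyLittlewood.GreenTaoLevelTwoMNTwoSixteenthFactor
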